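import Mathlib
import Literature.NumberTheory.LFunctions.MertensConjectureDisproof
import Literature.NumberTheory.LFunctions.LandauOscillation
import Literature.NumberTheory.LFunctions.MertensBoundRH
import Literature.NumberTheory.LFunctions.ZetaRealAxis
import HarnessLib

/-!
# One-sided bounds on `M(x)/√x`: Landau's theorem and the Laplace transform of `m(u) = M(e^u)e^{-u/2}`

Topic `Literature/NumberTheory/LFunctions` (trunk T-ANT). The number-theoretic input of the
kernel theorem of Ingham / Jurkat–Peyerimhoff / Odlyzko–te Riele
(`Literature.NumberTheory.LFunctions.OdlyzkoTeRiele1985_kernelTheorem` in `MertensConjectureDisproof.lean`), in the form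
consumed by the abstract oscillation theorem `Literature.NumberTheory.LFunctions.InghamSmoothing.frequently_gt_and_lt_of_laplace`
(`InghamSmoothing.lean`): under a one-sided bound on `m(u) = M(e^u)e^{-u/2}` ((2.6) of
Odlyzko–te Riele), the damped functions `m(u)e^{-σu}` are integrable for every `σ > 0` and the
Laplace transform of `m` is `1/((½+s)ζ(½+s))` on `0 < Re s < ½` — Bateman–Diamond §11.7 (proof
of Thm. 11.18: "`(½+s)⁻¹ζ(½+s)⁻¹ = ∫ x^{-s} M(x) x^{-1/2} dx/x =: G(s)`; the conditions of
Theorem 11.12 hold", after Lemma 11.16: a one-sided bound implies RH).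

## Main results (all proved)

* `mellin_mertensFunction` — `∫_{(1,∞)} M(x) x^{-(s+1)} dx = 1/(sζ(s))` for `Re s > 1`
  (Mathlib's `LSeries_eq_mul_integral'` and `MertensBoundRH.inv_riemannZeta_eq_LSeries`).
* `integrableOn_mertens_rpow_of_oneSided` — **Landau's theorem applied to `M`**: a one-sided
  bound `±M(x) ≤ A√x` (`x ≥ x₁`) gives `∫_1^∞ |M(x)| x^{-σ-1} dx < ∞` for every `σ > ½`. The
  non-negative function `g = A√x ∓ M` has transform `A/(s-½) ∓ 1/(sζ(s))`, holomorphic on a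
  neighbourhood of the real ray `(½, ∞)` (`exists_zetaZeroFree_rect`: no zeros of `ζ` in a thin
  rectangle about `[½,4]`; `differentiableAt_zetaInv`: the removable singularity of `1/ζ` at `1`,
  for `Literature.NumberTheory.LFunctions.MertensBoundRH.zetaInv`),
  and Landau's lemma `Literature.NumberTheory.LFunctions.Landau.integrableOn_of_differentiableOn_union_convex` (MV Lemma 15.1,
  `LandauOscillation.lean`) applies.
* `mellin_mertens_mul_eq_one`, `riemannZeta_ne_zero_of_mertens_integrable` — analytic
  continuation of the representation to `Re s > ½` (identity theorem on convex pieces,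
  `exists_convex_piece`), whence `ζ ≠ 0` there (B–D Lemma 11.16, first half).
* `laplace_normalizedMertens_eq_mellin`, `integrable_normalizedMertens_damped_iff` — the
  substitution `x = e^u` (Mathlib's one-variable change of variables for `exp`).
* `normalizedMertens_laplace_of_oneSided` — the packaged statement fed to the abstract theorem.

## References

* [BatemanDiamond2004] P. T. Bateman, H. G. Diamond, Analytic Number Theory: An Introductory
  Course, World Scientific 2004: §11.5 Thm. 11.12; §11.7 (Lemma 11.16, proof of Thm. 11.18).
* [OdlyzkoTeRiele1985] A. M. Odlyzko, H. J. J. te Riele, Disproof of the Mertens conjecture,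
  J. reine angew. Math. 357 (1985), 138–160: §2, (2.3)–(2.6), p. 141 and the Theorem on p. 144.
* [MontgomeryVaughan2007] H. L. Montgomery, R. C. Vaughan, Multiplicative Number Theory I, CUP
  2007: §15.1 Lemma 15.1 (Landau).
* [Titchmarsh1986] E. C. Titchmarsh, The Theory of the Riemann Zeta-Function, 2nd ed., §2.12.
-/

noncomputable section

open Complex Filter Asymptotics MeasureTheory Set
open scoped Real Topology

namespace Literature.NumberTheory.LFunctions

/-! ## `M(x)`: elementary facts -/

/-- `M(x) = Σ_{1 ≤ n ≤ x} μ(n)` written over `Finset.Icc 1 ⌊x⌋₊` (the indexing of Mathlib's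
`LSeries_eq_mul_integral`). [folklore] -/
theorem mertensFunction_eq_sum_Icc (x : ℝ) :
    mertensFunction x = ∑ n ∈ Finset.Icc 1 ⌊x⌋₊, ArithmeticFunction.moebius n := by
  unfold mertensFunction
  rw [← Finset.Icc_add_one_left_eq_Ioc, zero_add]

/-- `M(x) = 0` for `x < 1`. [folklore] -/
theorem mertensFunction_of_lt_one {x : ℝ} (hx : x < 1) : mertensFunction x = 0 := by
  unfold mertensFunction
  rw [Nat.floor_eq_zero.2 hx]
  simp

/-- The trivial bound `|M(x)| ≤ x` for `x ≥ 0`. [folklore] -/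
theorem abs_mertensFunction_le {x : ℝ} (hx : 0 ≤ x) : |(mertensFunction x : ℝ)| ≤ x := by
  unfold mertensFunction
  push_cast
  refine (Finset.abs_sum_le_sum_abs _ _).trans ?_
  calc ∑ n ∈ Finset.Ioc 0 ⌊x⌋₊, |((ArithmeticFunction.moebius n : ℤ) : ℝ)|
      ≤ ∑ n ∈ Finset.Ioc 0 ⌊x⌋₊, (1 : ℝ) := Finset.sum_le_sum fun n _ ↦ by
        exact_mod_cast ArithmeticFunction.abs_moebius_le_one
    _ = ⌊x⌋₊ := by simp
    _ ≤ x := Nat.floor_le hx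

/-- `x ↦ M(x)` is measurable (a function of `⌊x⌋₊`). [folklore] -/
theorem measurable_mertensFunction : Measurable (fun x : ℝ ↦ (mertensFunction x : ℝ)) := by
  have : (fun x : ℝ ↦ (mertensFunction x : ℝ)) =
      (fun n : ℕ ↦ ((∑ k ∈ Finset.Ioc 0 n, ArithmeticFunction.moebius k : ℤ) : ℝ)) ∘ Nat.floor := by
    ext x; rfl
  rw [this]
  exact measurable_from_nat.comp Nat.measurable_floor

/-! ## `m(u) = M(e^u) e^{-u/2}` ((2.5)–(2.6) of the source) -/

/-- `m(y) = M(x) x^{-1/2}` with `x = e^y`, i.e. `m(y) = M(e^y) e^{-y/2}` (Odlyzko–te Riele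
(2.5)–(2.6)); the function to which the abstract oscillation theorem of `InghamSmoothing.lean` is
applied. [cite: OdlyzkoTeRiele1985, §2 (2.6)] -/
def normalizedMertens (u : ℝ) : ℝ :=
  (mertensFunction (Real.exp u) : ℝ) * Real.exp (-(u / 2))

/-- `m = 0` on `(-∞, 0)` (`e^u < 1`). [cite: OdlyzkoTeRiele1985, §2 (2.6)] -/
theorem normalizedMertens_of_neg {u : ℝ} (hu : u < 0) : normalizedMertens u = 0 := by
  unfold normalizedMertens
  rw [mertensFunction_of_lt_one (Real.exp_lt_one_iff.2 hu)]
  simp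

/-- `|m(u)| ≤ e^{u/2}` (from `|M(x)| ≤ x`). [folklore] -/
theorem abs_normalizedMertens_le (u : ℝ) : |normalizedMertens u| ≤ Real.exp (u / 2) := by
  unfold normalizedMertens
  rw [abs_mul, abs_of_pos (Real.exp_pos _)]
  calc |(mertensFunction (Real.exp u) : ℝ)| * Real.exp (-(u / 2))
      ≤ Real.exp u * Real.exp (-(u / 2)) :=
        mul_le_mul_of_nonneg_right (abs_mertensFunction_le (Real.exp_pos u).le) (Real.exp_pos _).le
    _ = Real.exp (u / 2) := by rw [← Real.exp_add]; congr 1; ring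

/-- `m` is measurable. [folklore] -/
theorem measurable_normalizedMertens : Measurable normalizedMertens :=
  (measurable_mertensFunction.comp Real.measurable_exp).mul
    (Real.measurable_exp.comp (measurable_id.div_const 2).neg)

/-- `m` is locally bounded: `|m(u)| ≤ e^{b/2}` for `u ≤ b`. [folklore] -/
theorem normalizedMertens_locally_bounded (b : ℝ) : ∃ B : ℝ, ∀ u, u ≤ b → |normalizedMertens u| ≤ B :=
  ⟨Real.exp (b / 2), fun u hu ↦ (abs_normalizedMertens_le u).trans (Real.exp_le_exp.2 (by linarith))⟩

/-- From `m(y) > a` frequently as `y → ∞` to `M(x) > a √x` frequently as `x → ∞` (`x = e^y`,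
`√(e^y) = e^{y/2}`). [cite: OdlyzkoTeRiele1985, §2 (2.5)–(2.6)] -/
theorem frequently_mertens_gt_of_normalizedMertens {a : ℝ}
    (h : ∃ᶠ y : ℝ in atTop, a < normalizedMertens y) :
    ∃ᶠ x : ℝ in atTop, a * Real.sqrt x < mertensFunction x := by
  rw [← Real.map_exp_atTop, Filter.frequently_map]
  refine h.mono fun y hy ↦ ?_
  have hpos : 0 < Real.exp (y / 2) := Real.exp_pos _
  rw [← Real.exp_half]
  unfold normalizedMertens at hy
  rwa [Real.exp_neg, ← div_eq_mul_inv, lt_div_iff₀ hpos] at hy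

/-- From `m(y) < a` frequently as `y → ∞` to `M(x) < a √x` frequently as `x → ∞`.
[cite: OdlyzkoTeRiele1985, §2 (2.5)–(2.6)] -/
theorem frequently_mertens_lt_of_normalizedMertens {a : ℝ}
    (h : ∃ᶠ y : ℝ in atTop, normalizedMertens y < a) :
    ∃ᶠ x : ℝ in atTop, (mertensFunction x : ℝ) < a * Real.sqrt x := by
  rw [← Real.map_exp_atTop, Filter.frequently_map]
  refine h.mono fun y hy ↦ ?_
  have hpos : 0 < Real.exp (y / 2) := Real.exp_pos _
  rw [← Real.exp_half]
  unfold normalizedMertens at hy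
  rwa [Real.exp_neg, ← div_eq_mul_inv, div_lt_iff₀ hpos] at hy

/-- `e^{(log x)/2} = √x` for `x > 0`. [folklore] -/
theorem exp_log_half {x : ℝ} (hx : 0 < x) : Real.exp (Real.log x / 2) = Real.sqrt x := by
  rw [Real.sqrt_eq_rpow, Real.rpow_def_of_pos hx]
  congr 1; ring

/-- `m(log x) = M(x)/√x` for `x > 0`. [cite: OdlyzkoTeRiele1985, §2 (2.5)–(2.6)] -/
theorem normalizedMertens_log {x : ℝ} (hx : 0 < x) :
    normalizedMertens (Real.log x) = (mertensFunction x : ℝ) / Real.sqrt x := by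
  unfold normalizedMertens
  rw [Real.exp_log hx, Real.exp_neg, exp_log_half hx, div_eq_mul_inv]

/-- A one-sided bound `m ≤ A` gives `M(x) ≤ A √x` for `x > 0`.
[cite: OdlyzkoTeRiele1985, §2 (2.5)–(2.6)] -/
theorem mertens_le_of_normalizedMertens_le {A : ℝ} (h : ∀ u, normalizedMertens u ≤ A) {x : ℝ}
    (hx : 0 < x) : (mertensFunction x : ℝ) ≤ A * Real.sqrt x := by
  have h1 := h (Real.log x)
  rw [normalizedMertens_log hx, div_le_iff₀ (Real.sqrt_pos.2 hx)] at h1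
  exact h1

/-- A one-sided bound `-A ≤ m` gives `-(A √x) ≤ M(x)` for `x > 0`.
[cite: OdlyzkoTeRiele1985, §2 (2.5)–(2.6)] -/
theorem mertens_ge_of_le_normalizedMertens {A : ℝ} (h : ∀ u, -A ≤ normalizedMertens u) {x : ℝ}
    (hx : 0 < x) : -(A * Real.sqrt x) ≤ (mertensFunction x : ℝ) := by
  have h1 := h (Real.log x)
  rw [normalizedMertens_log hx, le_div_iff₀ (Real.sqrt_pos.2 hx)] at h1
  linarith

/-! ## The Mellin transform of `M`: `∫_1^∞ M(x) x^{-s-1} dx = 1/(s ζ(s))` for `Re s > 1` -/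

/-- **The Mellin transform of `M`** (the formula `1/ζ(s) = s ∫_1^∞ x^{-s-1} M(x) dx`,
`σ > 1`, of Bateman–Diamond §11.7; (2.3)/(2.10) of Odlyzko–te Riele in integrated form): in the
normalisation of `LandauOscillation.lean`, `∫_{(1,∞)} M(x) x^{-(s+1)} dx = 1/(s ζ(s))` for
`Re s > 1`. From Mathlib's `LSeries_eq_mul_integral'`. [cite: BatemanDiamond2004, §11.7 (display before Lemma 11.16)] -/
theorem mellin_mertensFunction {s : ℂ} (hs : 1 < s.re) :
    Landau.mellinIoi (fun x ↦ (mertensFunction x : ℝ)) s = 1 / (s * riemannZeta s) := by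
  have hO : (fun n : ℕ ↦ ∑ k ∈ Finset.Icc 1 n, ‖(ArithmeticFunction.moebius k : ℂ)‖) =O[atTop]
      fun n ↦ (n : ℝ) ^ (1 : ℝ) := by
    refine IsBigO.of_bound 1 (Eventually.of_forall fun n ↦ ?_)
    rw [Real.norm_eq_abs, Real.norm_eq_abs, Real.rpow_one, one_mul, Nat.abs_cast,
      abs_of_nonneg (Finset.sum_nonneg fun k _ ↦ norm_nonneg _)]
    calc ∑ k ∈ Finset.Icc 1 n, ‖(ArithmeticFunction.moebius k : ℂ)‖
        ≤ ∑ k ∈ Finset.Icc 1 n, (1 : ℝ) := Finset.sum_le_sum fun k _ ↦ by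
          rw [Complex.norm_intCast]
          exact_mod_cast ArithmeticFunction.abs_moebius_le_one
      _ = n := by simp
  have hs' : (1 : ℝ) < s.re := hs
  have hint := LSeries_eq_mul_integral' (fun n ↦ (ArithmeticFunction.moebius n : ℂ)) zero_le_one
    hs' hO
  rw [← MertensBoundRH.inv_riemannZeta_eq_LSeries hs] at hint
  have hM : ∀ t : ℝ, (((mertensFunction t : ℝ)) : ℂ) =
      ∑ k ∈ Finset.Icc 1 ⌊t⌋₊, (ArithmeticFunction.moebius k : ℂ) := by
    intro t; rw [mertensFunction_eq_sum_Icc]; push_cast; rfl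
  unfold Landau.mellinIoi
  simp_rw [hM]
  have hs0 : s ≠ 0 := by rintro rfl; simp at hs'; linarith
  have hζ : riemannZeta s ≠ 0 := riemannZeta_ne_zero_of_one_lt_re hs
  have : (∫ t in Set.Ioi (1 : ℝ), (∑ k ∈ Finset.Icc 1 ⌊t⌋₊, (ArithmeticFunction.moebius k : ℂ)) *
      (t : ℂ) ^ (-(s + 1))) = (riemannZeta s)⁻¹ / s := by
    rw [hint]; field_simp
  rw [this]
  field_simp

/-! ## The substitution `x = e^u` -/

/-- `(e^u)^w = e^{uw}` for real `u` and complex `w`. [folklore] -/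
theorem ofReal_exp_cpow (u : ℝ) (w : ℂ) : ((Real.exp u : ℝ) : ℂ) ^ w = cexp (u * w) := by
  rw [Complex.cpow_def_of_ne_zero (by exact_mod_cast (Real.exp_pos u).ne'),
    ← Complex.ofReal_log (Real.exp_pos u).le, Real.log_exp]

/-- Change of variables `x = e^u`: `∫_{(0,∞)} G(x) dx = ∫_ℝ e^u G(e^u) du` (Mathlib's one-variable
change-of-variables formula for the injective smooth map `exp` with image `(0, ∞)`). [folklore] -/
theorem integral_Ioi_eq_integral_exp {E : Type*} [NormedAddCommGroup E] [NormedSpace ℝ E] (G : ℝ → E) :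
    ∫ x in Set.Ioi (0 : ℝ), G x = ∫ u : ℝ, Real.exp u • G (Real.exp u) := by
  have h := integral_image_eq_integral_abs_deriv_smul (f := Real.exp) (f' := Real.exp)
    (s := Set.univ) MeasurableSet.univ (fun x _ ↦ (Real.hasDerivAt_exp x).hasDerivWithinAt)
    Real.exp_injective.injOn G
  rw [Set.image_univ, Real.range_exp, Measure.restrict_univ] at h
  rw [h]
  exact integral_congr_ae (ae_of_all _ fun u ↦ by dsimp only; rw [abs_of_pos (Real.exp_pos u)])

/-- Change of variables for integrability: `G` is integrable on `(0, ∞)` iff `u ↦ e^u G(e^u)` is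
integrable on `ℝ`. [folklore] -/
theorem integrableOn_Ioi_iff_integrable_exp {E : Type*} [NormedAddCommGroup E] [NormedSpace ℝ E]
    (G : ℝ → E) :
    IntegrableOn G (Set.Ioi (0 : ℝ)) ↔ Integrable (fun u : ℝ ↦ Real.exp u • G (Real.exp u)) := by
  have h := integrableOn_image_iff_integrableOn_abs_deriv_smul (f := Real.exp) (f' := Real.exp)
    (s := Set.univ) MeasurableSet.univ (fun x _ ↦ (Real.hasDerivAt_exp x).hasDerivWithinAt)
    Real.exp_injective.injOn G
  rw [Set.image_univ, Real.range_exp, integrableOn_univ] at h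
  rw [h]
  exact integrable_congr (ae_of_all _ fun u ↦ by dsimp only; rw [abs_of_pos (Real.exp_pos u)])

/-- The Mellin integrand of `M` vanishes a.e. off `(1, ∞)` (indeed off `[1, ∞)`), so its
integral over `(1, ∞)`, over `(0, ∞)` and over `ℝ` agree. [folklore] -/
theorem mertens_integrand_ae_zero {E : Type*} [NormedAddCommGroup E] [NormedSpace ℝ E] (φ : ℝ → E) :
    ∀ᵐ x : ℝ, x ∉ Set.Ioi (1 : ℝ) → (mertensFunction x : ℝ) • φ x = 0 := by
  have h1 : ∀ᵐ x : ℝ, x ≠ 1 := by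
    have : (volume : Measure ℝ) {1} = 0 := measure_singleton 1
    filter_upwards [compl_mem_ae_iff.2 this] with x hx
    simpa using hx
  filter_upwards [h1] with x hx hx1
  have : x < 1 := lt_of_le_of_ne (not_lt.1 hx1) hx
  rw [mertensFunction_of_lt_one this]; simp

/-- **The Laplace transform of `m` is the Mellin transform of `M`**:
`∫_ℝ m(u) e^{-(s-½)u} du = ∫_{(1,∞)} M(x) x^{-(s+1)} dx` for every `s` (both sides are `0` when
the integrals diverge). This is the identity `∫ m(y) e^{-sy} dy = ∫ x^{-s} M(x) x^{-1/2} dx/x` of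
Bateman–Diamond §11.7 (proof of Thm. 11.18). [cite: BatemanDiamond2004, §11.7 (proof of Theorem 11.18)] -/
theorem laplace_normalizedMertens_eq_mellin (s : ℂ) :
    ∫ u : ℝ, (normalizedMertens u : ℂ) * cexp (-((s - 1 / 2) * u)) =
      Landau.mellinIoi (fun x ↦ (mertensFunction x : ℝ)) s := by
  unfold Landau.mellinIoi
  set G : ℝ → ℂ := fun x ↦ (((mertensFunction x : ℝ)) : ℂ) * (x : ℂ) ^ (-(s + 1)) with hG
  have h0 : ∫ x in Set.Ioi (1 : ℝ), G x = ∫ x in Set.Ioi (0 : ℝ), G x := by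
    rw [setIntegral_eq_integral_of_ae_compl_eq_zero, setIntegral_eq_integral_of_ae_compl_eq_zero]
    · filter_upwards with x hx
      have : x < 1 := by simp only [Set.mem_Ioi, not_lt] at hx; linarith
      simp only [hG, mertensFunction_of_lt_one this]; simp
    · filter_upwards [mertens_integrand_ae_zero (fun x : ℝ ↦ (x : ℂ) ^ (-(s + 1)))] with x hx hx1
      have := hx hx1
      simp only [hG]
      rw [← Complex.real_smul] ; exact_mod_cast this
  rw [h0, integral_Ioi_eq_integral_exp]
  refine integral_congr_ae (ae_of_all _ fun u ↦ ?_)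
  simp only [hG]
  unfold normalizedMertens
  rw [ofReal_exp_cpow, Complex.real_smul]
  push_cast
  have e : cexp (-((u : ℂ) / 2)) * cexp (-((s - 1 / 2) * (u : ℂ))) =
      cexp (u : ℂ) * cexp ((u : ℂ) * -(s + 1)) := by
    rw [← Complex.exp_add, ← Complex.exp_add]; congr 1; ring
  linear_combination (↑(mertensFunction (Real.exp u)) : ℂ) * e

/-- Integrability transfers likewise: for real `σ`, `u ↦ m(u) e^{-σu}` is integrable on `ℝ` iff
`x ↦ M(x) x^{-(σ+½+1)}` is integrable on `(1, ∞)`. [cite: BatemanDiamond2004, §11.7 (proof of Theorem 11.18)] -/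
theorem integrable_normalizedMertens_damped_iff (σ : ℝ) :
    Integrable (fun u : ℝ ↦ normalizedMertens u * Real.exp (-(σ * u))) ↔
      IntegrableOn (fun x : ℝ ↦ (mertensFunction x : ℝ) * x ^ (-((σ + 1 / 2) + 1))) (Set.Ioi 1) := by
  set G : ℝ → ℝ := fun x ↦ (mertensFunction x : ℝ) * x ^ (-((σ + 1 / 2) + 1)) with hG
  have h1 : IntegrableOn G (Set.Ioi 1) ↔ IntegrableOn G (Set.Ioi 0) := by
    constructor
    · intro h
      have hsplit : Set.Ioi (0 : ℝ) = Set.Ioc 0 1 ∪ Set.Ioi 1 := (Set.Ioc_union_Ioi_eq_Ioi zero_le_one).symm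
      rw [hsplit]
      refine IntegrableOn.union ?_ h
      refine (integrableOn_zero).congr_fun_ae ?_
      rw [EventuallyEq, ae_restrict_iff' measurableSet_Ioc]
      filter_upwards [mertens_integrand_ae_zero (fun x : ℝ ↦ x ^ (-((σ + 1 / 2) + 1)))] with x hx hx1
      have : x ∉ Set.Ioi (1 : ℝ) := by simp only [Set.mem_Ioi, not_lt]; exact hx1.2
      have := hx this
      rw [smul_eq_mul] at this
      simp only [hG]
      exact this.symm
    · exact fun h ↦ h.mono_set (Set.Ioi_subset_Ioi zero_le_one)
  rw [h1, integrableOn_Ioi_iff_integrable_exp]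
  refine integrable_congr (ae_of_all _ fun u ↦ ?_)
  simp only [hG, smul_eq_mul]
  unfold normalizedMertens
  rw [Real.rpow_def_of_pos (Real.exp_pos u), Real.log_exp]
  have : Real.exp u * ((mertensFunction (Real.exp u) : ℝ) * Real.exp (u * -((σ + 1 / 2) + 1))) =
      (mertensFunction (Real.exp u) : ℝ) * (Real.exp u * Real.exp (u * -((σ + 1 / 2) + 1))) := by ring
  rw [this, ← Real.exp_add, mul_assoc, ← Real.exp_add]
  congr 2; ring

/-! ## Landau's theorem: a one-sided bound on `M(x)/√x` forces absolute convergence for `σ > ½` -/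

/-- `ζ(s) ≠ 0` in a punctured neighbourhood of `1` (pole). [folklore] -/
theorem eventually_riemannZeta_ne_zero_nhds_one : ∀ᶠ s in 𝓝[≠] (1 : ℂ), riemannZeta s ≠ 0 := by
  have h := riemannZeta_residue_one
  have : ∀ᶠ s in 𝓝[≠] (1 : ℂ), (s - 1) * riemannZeta s ≠ 0 :=
    h.eventually_ne one_ne_zero
  filter_upwards [this] with s hs
  exact fun h0 ↦ hs (by rw [h0, mul_zero])

/-- `MertensBoundRH.zetaInv` (`1/ζ` with the removable singularity at `1` filled in) is
differentiable at every point where `ζ ≠ 0`, and at `s = 1` (continuity at `1`,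
`MertensBoundRH.continuousAt_zetaInv_one`, and differentiability on a punctured neighbourhood).
Unconditional form of `MertensBoundRH.differentiableAt_zetaInv_of_ne_one` (which assumes RH).
[folklore] -/
theorem differentiableAt_zetaInv {s : ℂ} (h : s = 1 ∨ riemannZeta s ≠ 0) :
    DifferentiableAt ℂ MertensBoundRH.zetaInv s := by
  -- off `1`, where `ζ ≠ 0`
  have hoff : ∀ z : ℂ, z ≠ 1 → riemannZeta z ≠ 0 → DifferentiableAt ℂ MertensBoundRH.zetaInv z := by
    intro z hz hζ
    have hev : MertensBoundRH.zetaInv =ᶠ[𝓝 z] fun w ↦ (riemannZeta w)⁻¹ := by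
      filter_upwards [isOpen_compl_singleton.mem_nhds hz] with w hw
      exact MertensBoundRH.zetaInv_of_ne_one hw
    exact ((differentiableAt_riemannZeta hz).inv hζ).congr_of_eventuallyEq hev
  have hone : DifferentiableAt ℂ MertensBoundRH.zetaInv 1 := by
    have hd : ∀ᶠ z in 𝓝[≠] (1 : ℂ), DifferentiableAt ℂ MertensBoundRH.zetaInv z := by
      filter_upwards [eventually_riemannZeta_ne_zero_nhds_one, self_mem_nhdsWithin] with z hz hz1
      exact hoff z hz1 hz
    exact (analyticAt_of_differentiable_on_punctured_nhds_of_continuousAt hd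
      MertensBoundRH.continuousAt_zetaInv_one).differentiableAt
  rcases h with rfl | hζ
  · exact hone
  · by_cases hs : s = 1
    · rw [hs]; exact hone
    · exact hoff s hs hζ

/-- **A zero-free rectangle about the real segment `[½, 4]`**: there is `δ > 0` such that
`ζ(s) ≠ 0` for `½ ≤ Re s ≤ 4`, `|Im s| < δ` (finitely many zeros in the compact box
`[½,4] × [-1,1]`, none of them real: `ζ(σ) < 0` on `(0,1)` and `ζ ≠ 0` on `Re s ≥ 1`).
[cite: Titchmarsh1986, §2.12] -/
theorem exists_zetaZeroFree_rect :
    ∃ δ : ℝ, 0 < δ ∧ ∀ s : ℂ, 1 / 2 ≤ s.re → s.re ≤ 4 → |s.im| < δ → riemannZeta s ≠ 0 := by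
  have hfin := ((isCompact_Icc (a := (1 / 2 : ℝ)) (b := 4)).reProdIm
    (isCompact_Icc (a := (-1 : ℝ)) (b := 1))).inter_riemannZetaZeros_finite
  set Z := hfin.toFinset with hZ
  have hmemZ : ∀ s : ℂ, 1 / 2 ≤ s.re → s.re ≤ 4 → |s.im| ≤ 1 → riemannZeta s = 0 → s ∈ Z := by
    intro s h1 h2 h3 hζ
    rw [hZ, Set.Finite.mem_toFinset]
    exact ⟨Complex.mem_reProdIm.2 ⟨⟨h1, h2⟩, abs_le.1 h3⟩, hζ⟩
  have him : ∀ z ∈ Z, z.im ≠ 0 := by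
    intro z hz h0
    rw [hZ, Set.Finite.mem_toFinset] at hz
    obtain ⟨hzK, hz0⟩ := hz
    rw [mem_riemannZetaZeros] at hz0
    rw [Complex.mem_reProdIm] at hzK
    rcases lt_or_ge z.re 1 with h1 | h1
    · exact riemannZeta_ne_zero_of_im_eq_zero_of_pos_of_lt_one h0 (by linarith [hzK.1.1]) h1 hz0
    · exact riemannZeta_ne_zero_of_one_le_re h1 hz0
  by_cases hne : Z.Nonempty
  · set δ : ℝ := min 1 (Z.inf' hne fun z ↦ |z.im|) with hδ
    have hδpos : 0 < δ :=
      lt_min one_pos ((Finset.lt_inf'_iff hne).2 fun z hz ↦ abs_pos.2 (him z hz))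
    refine ⟨δ, hδpos, fun s h1 h2 h3 hζ ↦ ?_⟩
    have hsZ : s ∈ Z := hmemZ s h1 h2 (h3.le.trans (min_le_left _ _)) hζ
    have : δ ≤ |s.im| := (min_le_right _ _).trans (Finset.inf'_le _ hsZ)
    linarith
  · refine ⟨1, one_pos, fun s h1 h2 h3 hζ ↦ hne ⟨s, hmemZ s h1 h2 h3.le hζ⟩⟩

/-- `∫_{(1,∞)} √x · x^{-(s+1)} dx = 1/(s - ½)` for `Re s > ½`. [folklore] -/
theorem integral_sqrt_mul_cpow {s : ℂ} (hs : 1 / 2 < s.re) :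
    ∫ x in Set.Ioi (1 : ℝ), ((Real.sqrt x : ℝ) : ℂ) * (x : ℂ) ^ (-(s + 1)) = 1 / (s - 1 / 2) := by
  have heq : EqOn (fun x : ℝ ↦ ((Real.sqrt x : ℝ) : ℂ) * (x : ℂ) ^ (-(s + 1)))
      (fun x : ℝ ↦ (x : ℂ) ^ (-(s + 1 / 2))) (Set.Ioi 1) := by
    intro x hx
    have hx0 : 0 < x := by simp only [Set.mem_Ioi] at hx; linarith
    simp only
    rw [Real.sqrt_eq_rpow, Complex.ofReal_cpow hx0.le, ← Complex.cpow_add _ _ (by exact_mod_cast hx0.ne')]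
    congr 1; push_cast; ring
  rw [setIntegral_congr_fun measurableSet_Ioi heq,
    integral_Ioi_cpow_of_lt (by simp; linarith) zero_lt_one]
  have : (-(s + 1 / 2) + 1) = -(s - 1 / 2) := by ring
  rw [Complex.ofReal_one, Complex.one_cpow, this]
  have hne : s - 1 / 2 ≠ 0 := by
    intro h; have := congrArg Complex.re h; simp at this; linarith
  field_simp

/-- Integrability of `√x · x^{-(s+1)}` on `(1, ∞)` for `Re s > ½`. [folklore] -/
theorem integrableOn_sqrt_mul_cpow {s : ℂ} (hs : 1 / 2 < s.re) :
    IntegrableOn (fun x : ℝ ↦ ((Real.sqrt x : ℝ) : ℂ) * (x : ℂ) ^ (-(s + 1))) (Set.Ioi 1) := by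
  have heq : EqOn (fun x : ℝ ↦ (x : ℂ) ^ (-(s + 1 / 2)))
      (fun x : ℝ ↦ ((Real.sqrt x : ℝ) : ℂ) * (x : ℂ) ^ (-(s + 1))) (Set.Ioi 1) := by
    intro x hx
    have hx0 : 0 < x := by simp only [Set.mem_Ioi] at hx; linarith
    simp only
    rw [Real.sqrt_eq_rpow, Complex.ofReal_cpow hx0.le, ← Complex.cpow_add _ _ (by exact_mod_cast hx0.ne')]
    congr 1; push_cast; ring
  exact (integrableOn_Ioi_cpow_of_lt (by simp; linarith) zero_lt_one).congr_fun heq measurableSet_Ioi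

/-- Integrability of `√x · x^{-(σ+1)}` (real) on `(1, ∞)` for `σ > ½`. [folklore] -/
theorem integrableOn_sqrt_mul_rpow {σ : ℝ} (hσ : 1 / 2 < σ) :
    IntegrableOn (fun x : ℝ ↦ Real.sqrt x * x ^ (-(σ + 1))) (Set.Ioi 1) := by
  have heq : EqOn (fun x : ℝ ↦ x ^ (-(σ + 1 / 2))) (fun x : ℝ ↦ Real.sqrt x * x ^ (-(σ + 1)))
      (Set.Ioi 1) := by
    intro x hx
    have hx0 : 0 < x := by simp only [Set.mem_Ioi] at hx; linarith
    simp only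
    rw [Real.sqrt_eq_rpow, ← Real.rpow_add hx0]
    congr 1; ring
  exact (integrableOn_Ioi_rpow_of_lt (by linarith) zero_lt_one).congr_fun heq measurableSet_Ioi

/-- Integrability of the Mellin integrand of `M` for `Re s > 1` (trivial bound `|M(x)| ≤ x`).
[folklore] -/
theorem integrableOn_mertens_mul_cpow {s : ℂ} (hs : 1 < s.re) :
    IntegrableOn (fun x : ℝ ↦ (((mertensFunction x : ℝ)) : ℂ) * (x : ℂ) ^ (-(s + 1))) (Set.Ioi 1) := by
  refine Integrable.mono' ((integrableOn_Ioi_rpow_of_lt (show -s.re < -1 by linarith) zero_lt_one))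
    ?_ ?_
  · exact ((Complex.continuous_ofReal.measurable.comp measurable_mertensFunction).mul
      (Complex.measurable_ofReal.pow_const _)).aestronglyMeasurable
  · rw [ae_restrict_iff' measurableSet_Ioi]
    refine ae_of_all _ fun x hx ↦ ?_
    have hx0 : 0 < x := by simp only [Set.mem_Ioi] at hx; linarith
    rw [norm_mul, Complex.norm_real, Real.norm_eq_abs,
      Complex.norm_cpow_eq_rpow_re_of_pos hx0]
    calc |(mertensFunction x : ℝ)| * x ^ (-(s + 1)).re ≤ x * x ^ (-(s + 1)).re :=
          mul_le_mul_of_nonneg_right (abs_mertensFunction_le hx0.le) (Real.rpow_nonneg hx0.le _)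
      _ = x ^ (-s.re) := by
          rw [show (-(s + 1)).re = -s.re - 1 by simp; ring, Real.rpow_sub hx0, Real.rpow_one]
          field_simp

/-- **Landau's theorem applied to `M`** (Bateman–Diamond Lemma 11.16, first half, and the Landau
step of Thm. 11.12's application in §11.7; Odlyzko–te Riele §2 p. 141: a one-sided bound
`M(x) ≤ A√x` or `M(x) ≥ -A√x` implies RH and the convergence of `∫ |M(x)| x^{-σ-1} dx` for
`σ > ½`): the non-negative function `g(x) = A√x ∓ M(x)` has Mellin transform
`A/(s-½) ∓ 1/(sζ(s))`, holomorphic on a neighbourhood of the real ray `(½, ∞)` (no real zeros of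
`ζ`, removable singularity of `1/ζ` at `1`), so by Landau's lemma (`LandauOscillation.lean`,
MV Lemma 15.1) the integral converges absolutely for every `σ > ½`.
[cite: BatemanDiamond2004, Lemma 11.16 and §11.7; MontgomeryVaughan2007, §15.1 Lemma 15.1] -/
theorem integrableOn_mertens_rpow_of_oneSided {A x₁ η : ℝ} (hη : η = 1 ∨ η = -1)
    (hb : ∀ x, x₁ ≤ x → η * (mertensFunction x : ℝ) ≤ A * Real.sqrt x) {σ : ℝ} (hσ : 1 / 2 < σ) :
    IntegrableOn (fun x ↦ (mertensFunction x : ℝ) * x ^ (-(σ + 1))) (Set.Ioi 1) := by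
  have hηsq : η * η = 1 := by rcases hη with rfl | rfl <;> norm_num
  have hηabs : |η| = 1 := by rcases hη with rfl | rfl <;> norm_num
  -- the non-negative function
  set g : ℝ → ℝ := fun x ↦ A * Real.sqrt x - η * (mertensFunction x : ℝ) with hg
  have hgm : Measurable g :=
    (measurable_const.mul Real.continuous_sqrt.measurable).sub
      (measurable_const.mul measurable_mertensFunction)
  have hX₁ : (1 : ℝ) ≤ max x₁ 1 := le_max_right _ _
  have hpos : ∀ x, max x₁ 1 < x → 0 ≤ g x := fun x hx ↦
    sub_nonneg.2 (hb x ((le_max_left _ _).trans hx.le))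
  -- absolute convergence at `σ₁ = 2`
  have hint : IntegrableOn (fun x ↦ g x * x ^ (-((2 : ℝ) + 1))) (Set.Ioi 1) := by
    refine Integrable.mono'
      ((integrableOn_Ioi_rpow_of_lt (by norm_num : (-2 : ℝ) < -1) zero_lt_one).const_mul (|A| + 1))
      ((hgm.mul (measurable_id.pow_const _)).aestronglyMeasurable) ?_
    rw [ae_restrict_iff' measurableSet_Ioi]
    refine ae_of_all _ fun x hx ↦ ?_
    have hx1 : 1 < x := hx
    have hx0 : 0 < x := by linarith
    have hsx : Real.sqrt x ≤ x := by
      have h1 : 1 ≤ Real.sqrt x := Real.one_le_sqrt.mpr hx1.le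
      nlinarith [Real.mul_self_sqrt hx0.le, Real.sqrt_nonneg x]
    have hgx : |g x| ≤ (|A| + 1) * x := by
      simp only [hg]
      calc |A * Real.sqrt x - η * (mertensFunction x : ℝ)|
          ≤ |A * Real.sqrt x| + |η * (mertensFunction x : ℝ)| := abs_sub _ _
        _ = |A| * Real.sqrt x + |(mertensFunction x : ℝ)| := by
            rw [abs_mul, abs_mul, hηabs, one_mul, abs_of_nonneg (Real.sqrt_nonneg x)]
        _ ≤ |A| * x + x := add_le_add (mul_le_mul_of_nonneg_left hsx (abs_nonneg A))
            (abs_mertensFunction_le hx0.le)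
        _ = (|A| + 1) * x := by ring
    rw [Real.norm_eq_abs, abs_mul, abs_of_nonneg (Real.rpow_nonneg hx0.le _)]
    calc |g x| * x ^ (-((2 : ℝ) + 1)) ≤ (|A| + 1) * x * x ^ (-((2 : ℝ) + 1)) :=
          mul_le_mul_of_nonneg_right hgx (Real.rpow_nonneg hx0.le _)
      _ = (|A| + 1) * x ^ (-2 : ℝ) := by
          rw [show (-((2 : ℝ) + 1)) = -2 - 1 by norm_num, Real.rpow_sub hx0, Real.rpow_one]
          field_simp
  -- the continuation `Φ(s) = A/(s - ½) - η/(s ζ(s))`, holomorphic on a neighbourhood of `(½, ∞)`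
  obtain ⟨δ, hδ, hδζ⟩ := exists_zetaZeroFree_rect
  set W₀ : Set ℂ := {s : ℂ | 1 / 2 < s.re ∧ s.re < 4 ∧ -δ < s.im ∧ s.im < δ} with hW₀
  set Φ : ℂ → ℂ := fun s ↦ (A : ℂ) / (s - 1 / 2) - (η : ℂ) * (MertensBoundRH.zetaInv s / s) with hΦ
  have hW₀o : IsOpen W₀ := by
    refine ((isOpen_lt continuous_const Complex.continuous_re).inter
      ((isOpen_lt Complex.continuous_re continuous_const).inter
      ((isOpen_lt continuous_const Complex.continuous_im).inter
      (isOpen_lt Complex.continuous_im continuous_const))))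
  have hW₀c : Convex ℝ W₀ := by
    have : W₀ = {s : ℂ | 1 / 2 < s.re} ∩ ({s : ℂ | s.re < 4} ∩ ({s : ℂ | -δ < s.im} ∩
        {s : ℂ | s.im < δ})) := by
      ext s; simp [hW₀]
    rw [this]
    exact (convex_halfSpace_re_gt _).inter ((convex_halfSpace_re_lt _).inter
      ((convex_halfSpace_im_gt _).inter (convex_halfSpace_im_lt _)))
  have hW₀r : ∀ σ' : ℝ, 1 / 2 < σ' → σ' ≤ 2 + 1 → (σ' : ℂ) ∈ W₀ := by
    intro σ' h1 h2
    simp only [hW₀, Set.mem_setOf_eq, Complex.ofReal_re, Complex.ofReal_im]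
    exact ⟨h1, by linarith, by linarith, hδ⟩
  have hΦd : DifferentiableOn ℂ Φ ({s : ℂ | 2 < s.re} ∪ W₀) := by
    intro s hs
    apply DifferentiableAt.differentiableWithinAt
    have hre : 1 / 2 < s.re := by
      rcases hs with hs | hs
      · simp only [Set.mem_setOf_eq] at hs; linarith
      · exact hs.1
    have hs0 : s ≠ 0 := by
      intro h; rw [h] at hre; simp at hre; linarith
    have hs12 : s - 1 / 2 ≠ 0 := by
      intro h; have := congrArg Complex.re h; simp at this; linarith
    have hζ : s = 1 ∨ riemannZeta s ≠ 0 := by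
      rcases hs with hs | hs
      · right
        simp only [Set.mem_setOf_eq] at hs
        exact riemannZeta_ne_zero_of_one_lt_re (by linarith)
      · by_cases h1 : s = 1
        · exact Or.inl h1
        · exact Or.inr (hδζ s hs.1.le (by linarith [hs.2.1]) (abs_lt.2 ⟨hs.2.2.1, hs.2.2.2⟩))
    have d1 : DifferentiableAt ℂ (fun z : ℂ ↦ (A : ℂ) / (z - 1 / 2)) s :=
      (differentiableAt_const _).div (differentiableAt_id.sub_const _) hs12
    have d2 : DifferentiableAt ℂ (fun z : ℂ ↦ MertensBoundRH.zetaInv z / z) s :=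
      (differentiableAt_zetaInv hζ).div differentiableAt_id hs0
    have d3 : DifferentiableAt ℂ (fun z : ℂ ↦ (η : ℂ) * (MertensBoundRH.zetaInv z / z)) s := d2.const_mul _
    exact d1.sub d3
  have hagree : EqOn Φ (Landau.mellinIoi g) {s : ℂ | 2 < s.re} := by
    intro s hs
    simp only [Set.mem_setOf_eq] at hs
    have hs1 : 1 < s.re := by linarith
    have hs12 : 1 / 2 < s.re := by linarith
    have hsne1 : s ≠ 1 := by
      intro h; rw [h] at hs; norm_num at hs
    have h1 := integral_sqrt_mul_cpow hs12
    have h2 := mellin_mertensFunction hs1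
    unfold Landau.mellinIoi at h2 ⊢
    have hsplit : ∀ x : ℝ, ((g x : ℝ) : ℂ) * (x : ℂ) ^ (-(s + 1)) =
        (A : ℂ) * (((Real.sqrt x : ℝ) : ℂ) * (x : ℂ) ^ (-(s + 1))) -
          (η : ℂ) * ((((mertensFunction x : ℝ)) : ℂ) * (x : ℂ) ^ (-(s + 1))) := by
      intro x; simp only [hg]; push_cast; ring
    simp_rw [hsplit]
    rw [integral_sub ((integrableOn_sqrt_mul_cpow hs12).const_mul _)
      ((integrableOn_mertens_mul_cpow hs1).const_mul _), integral_const_mul, integral_const_mul,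
      h1, h2]
    simp only [hΦ, MertensBoundRH.zetaInv_of_ne_one hsne1]
    have hs0 : s ≠ 0 := by
      intro h; rw [h] at hs; norm_num at hs
    field_simp
  -- Landau's lemma
  have hL := Landau.integrableOn_of_differentiableOn_union_convex hgm hint hX₁ hpos
    (by norm_num : (1 / 2 : ℝ) < 2) hW₀o hW₀c hW₀r hΦd hagree hσ
  -- back to `M = η (A√x - g)`
  have hM : ∀ x : ℝ, (mertensFunction x : ℝ) * x ^ (-(σ + 1)) =
      η * A * (Real.sqrt x * x ^ (-(σ + 1))) - η * (g x * x ^ (-(σ + 1))) := by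
    intro x
    simp only [hg]
    linear_combination (-((mertensFunction x : ℝ) * x ^ (-(σ + 1)))) * hηsq
  have : (fun x ↦ (mertensFunction x : ℝ) * x ^ (-(σ + 1))) = fun x ↦
      η * A * (Real.sqrt x * x ^ (-(σ + 1))) - η * (g x * x ^ (-(σ + 1))) := funext hM
  rw [this]
  exact ((integrableOn_sqrt_mul_rpow hσ).const_mul _).sub (hL.const_mul _)

/-! ## Analytic continuation: `∫_1^∞ M(x) x^{-s-1} dx = 1/(s ζ(s))` on `Re s > ½` -/

/-- The half-plane `{s | ½ < Re s}` minus the point `1` is covered by convex open pieces each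
containing a point of `{Re s > 1}`; this is the identity-theorem step "by analytic continuation
the representation holds for `σ > ½`" of Bateman–Diamond §11.7, done on convex pieces to avoid a
connectedness argument for a slit half-plane (as in `LittlewoodCriterion.lean`). [folklore] -/
theorem exists_convex_piece {s : ℂ} (hs : 1 / 2 < s.re) (hs1 : s ≠ 1) :
    ∃ V : Set ℂ, IsOpen V ∧ Convex ℝ V ∧ s ∈ V ∧ V ⊆ {z : ℂ | 1 / 2 < z.re} ∧ (1 : ℂ) ∉ V ∧
      ∃ z₀ ∈ V, 1 < z₀.re := by
  rcases lt_trichotomy s.im 0 with him | him | him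
  · refine ⟨{z : ℂ | 1 / 2 < z.re} ∩ {z : ℂ | z.im < 0},
      (isOpen_lt continuous_const Complex.continuous_re).inter
        (isOpen_lt Complex.continuous_im continuous_const),
      (convex_halfSpace_re_gt _).inter (convex_halfSpace_im_lt _), ⟨hs, him⟩,
      Set.inter_subset_left, by simp, ⟨2 - I, ⟨by norm_num, by simp⟩, by simp⟩⟩
  · -- `s` is real, `s ≠ 1`
    rcases lt_or_gt_of_ne (show s.re ≠ 1 from fun h ↦ hs1 (Complex.ext (by simpa using h)
      (by simpa using him))) with hre | hre
    · refine ⟨{z : ℂ | 1 / 2 < z.re} ∩ {z : ℂ | z.re - z.im < 1},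
        (isOpen_lt continuous_const Complex.continuous_re).inter
          (isOpen_lt (Complex.continuous_re.sub Complex.continuous_im) continuous_const),
        (convex_halfSpace_re_gt _).inter (convex_halfSpace_lt ?_ _), ⟨hs, by simp [him]; linarith⟩,
        Set.inter_subset_left, by simp, ⟨2 + 2 * I, ⟨by norm_num, by simp⟩, by simp⟩⟩
      exact IsLinearMap.mk (fun x y ↦ by simp; ring) (fun c x ↦ by simp; ring)
    · refine ⟨{z : ℂ | 1 < z.re}, isOpen_lt continuous_const Complex.continuous_re,
        convex_halfSpace_re_gt _, hre, fun z hz ↦ ?_, by simp, ⟨s, hre, hre⟩⟩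
      simp only [Set.mem_setOf_eq] at hz ⊢; linarith
  · refine ⟨{z : ℂ | 1 / 2 < z.re} ∩ {z : ℂ | 0 < z.im},
      (isOpen_lt continuous_const Complex.continuous_re).inter
        (isOpen_lt continuous_const Complex.continuous_im),
      (convex_halfSpace_re_gt _).inter (convex_halfSpace_im_gt _), ⟨hs, him⟩,
      Set.inter_subset_left, by simp, ⟨2 + I, ⟨by norm_num, by simp⟩, by simp⟩⟩

/-- **Analytic continuation of the Mellin representation** (Bateman–Diamond §11.7: "provides an
analytic continuation of `1/ζ` to the half plane `σ > ½`"): if `∫_1^∞ |M(x)| x^{-σ-1} dx < ∞`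
for every `σ > ½`, then `(∫_1^∞ M(x) x^{-s-1} dx) · s ζ(s) = 1` for all `Re s > ½`, `s ≠ 1`
(identity theorem on the convex pieces of `exists_convex_piece`). In particular `ζ(s) ≠ 0` there.
[cite: BatemanDiamond2004, §11.7 (display before Lemma 11.16)] -/
theorem mellin_mertens_mul_eq_one
    (hI : ∀ σ : ℝ, 1 / 2 < σ → IntegrableOn (fun x ↦ (mertensFunction x : ℝ) * x ^ (-(σ + 1))) (Set.Ioi 1))
    {s : ℂ} (hs : 1 / 2 < s.re) (hs1 : s ≠ 1) :
    Landau.mellinIoi (fun x ↦ (mertensFunction x : ℝ)) s * (s * riemannZeta s) = 1 := by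
  set F : ℂ → ℂ := Landau.mellinIoi (fun x ↦ (mertensFunction x : ℝ)) with hF
  have hFd : DifferentiableOn ℂ F {z : ℂ | 1 / 2 < z.re} :=
    Landau.differentiableOn_mellinIoi_of_forall measurable_mertensFunction hI
  obtain ⟨V, hVo, hVc, hsV, hVsub, h1V, z₀, hz₀V, hz₀⟩ := exists_convex_piece hs hs1
  set Ψ : ℂ → ℂ := fun z ↦ F z * (z * riemannZeta z) - 1 with hΨ
  have hΨd : DifferentiableOn ℂ Ψ V := by
    intro z hz
    have hz1 : z ≠ 1 := fun h ↦ h1V (h ▸ hz)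
    refine (((hFd z (hVsub hz)).differentiableAt ((isOpen_lt continuous_const
      Complex.continuous_re).mem_nhds (hVsub hz))).mul
      (differentiableAt_id.mul (differentiableAt_riemannZeta hz1))).differentiableWithinAt.sub_const _
  have hΨa : AnalyticOnNhd ℂ Ψ V := hΨd.analyticOnNhd hVo
  have hev : Ψ =ᶠ[𝓝 z₀] 0 := by
    have ho : IsOpen (V ∩ {z : ℂ | 1 < z.re}) :=
      hVo.inter (isOpen_lt continuous_const Complex.continuous_re)
    filter_upwards [ho.mem_nhds ⟨hz₀V, hz₀⟩] with z hz
    have hz1 : 1 < z.re := hz.2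
    simp only [hΨ, hF, Pi.zero_apply, mellin_mertensFunction hz1]
    have hζ := riemannZeta_ne_zero_of_one_lt_re hz1
    have hz0 : z ≠ 0 := by rintro rfl; simp at hz1; linarith
    field_simp
    ring
  have hzero := hΨa.eqOn_zero_of_preconnected_of_eventuallyEq_zero hVc.isPreconnected hz₀V hev
  have := hzero hsV
  simp only [hΨ, Pi.zero_apply, sub_eq_zero] at this
  exact this

/-- Corollary: under the same hypothesis `ζ(s) ≠ 0` for `Re s > ½` (the Riemann hypothesis
follows from a one-sided bound: Bateman–Diamond Lemma 11.16, first assertion).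
[cite: BatemanDiamond2004, Lemma 11.16] -/
theorem riemannZeta_ne_zero_of_mertens_integrable
    (hI : ∀ σ : ℝ, 1 / 2 < σ → IntegrableOn (fun x ↦ (mertensFunction x : ℝ) * x ^ (-(σ + 1))) (Set.Ioi 1))
    {s : ℂ} (hs : 1 / 2 < s.re) : riemannZeta s ≠ 0 := by
  by_cases hs1 : s = 1
  · rw [hs1]; exact riemannZeta_one_ne_zero
  · intro h0
    have := mellin_mertens_mul_eq_one hI hs hs1
    rw [h0, mul_zero, mul_zero] at this
    exact zero_ne_one this

/-- Corollary: the Mellin representation `∫_1^∞ M(x) x^{-s-1} dx = 1/(s ζ(s))` on `Re s > ½`,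
`s ≠ 1`. [cite: BatemanDiamond2004, §11.7] -/
theorem mellin_mertens_eq_of_integrable
    (hI : ∀ σ : ℝ, 1 / 2 < σ → IntegrableOn (fun x ↦ (mertensFunction x : ℝ) * x ^ (-(σ + 1))) (Set.Ioi 1))
    {s : ℂ} (hs : 1 / 2 < s.re) (hs1 : s ≠ 1) :
    Landau.mellinIoi (fun x ↦ (mertensFunction x : ℝ)) s = 1 / (s * riemannZeta s) := by
  have h := mellin_mertens_mul_eq_one hI hs hs1
  have hζ := riemannZeta_ne_zero_of_mertens_integrable hI hs
  have hs0 : s ≠ 0 := by rintro rfl; simp at hs; linarith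
  field_simp
  linear_combination h

/-! ## The Laplace transform of `m` under a one-sided bound -/

/-- **The Laplace input of the kernel theorem** (Odlyzko–te Riele §2, p. 141–143; Bateman–Diamond
§11.7, proof of Thm. 11.18: "`(½+s)⁻¹ ζ(½+s)⁻¹ = ∫ x^{-s} M(x) x^{-1/2} dx/x =: G(s)`; the conditions
of Theorem 11.12 hold"): under a one-sided bound `m ≤ A` or `m ≥ -A` on `m(u) = M(e^u)e^{-u/2}`,
the damped functions `m(u)e^{-σu}` are integrable for every `σ > 0` (Landau), and for
`0 < σ < ½` and all real `t`,
`∫ m(u) e^{-(σ+it)u} du = 1/((½+σ+it) ζ(½+σ+it))`.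
[cite: BatemanDiamond2004, §11.7 (proof of Theorem 11.18); OdlyzkoTeRiele1985, §2 p. 141] -/
theorem normalizedMertens_laplace_of_oneSided {A : ℝ}
    (h : (∀ u, normalizedMertens u ≤ A) ∨ (∀ u, -A ≤ normalizedMertens u)) :
    (∀ σ : ℝ, 0 < σ → Integrable (fun u ↦ normalizedMertens u * Real.exp (-(σ * u)))) ∧
    ∀ σ t : ℝ, 0 < σ → σ < 1 / 2 →
      ∫ u : ℝ, (normalizedMertens u : ℂ) * cexp (-(((σ : ℂ) + t * I) * u)) =
        1 / ((1 / 2 + σ + t * I) * riemannZeta (1 / 2 + σ + t * I)) := by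
  -- the one-sided bound in the `x`-variable and Landau
  have hI : ∀ σ : ℝ, 1 / 2 < σ →
      IntegrableOn (fun x ↦ (mertensFunction x : ℝ) * x ^ (-(σ + 1))) (Set.Ioi 1) := by
    intro σ hσ
    rcases h with h | h
    · refine integrableOn_mertens_rpow_of_oneSided (η := 1) (x₁ := 1) (A := A) (Or.inl rfl)
        (fun x hx ↦ ?_) hσ
      rw [one_mul]; exact mertens_le_of_normalizedMertens_le h (by linarith)
    · refine integrableOn_mertens_rpow_of_oneSided (η := -1) (x₁ := 1) (A := A) (Or.inr rfl)
        (fun x hx ↦ ?_) hσ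
      have := mertens_ge_of_le_normalizedMertens h (show (0 : ℝ) < x by linarith)
      linarith
  refine ⟨fun σ hσ ↦ ?_, fun σ t hσ hσ' ↦ ?_⟩
  · rw [integrable_normalizedMertens_damped_iff]
    exact hI _ (by linarith)
  · have hs : 1 / 2 < ((1 / 2 : ℂ) + σ + t * I).re := by simp; exact hσ
    have hs1 : (1 / 2 : ℂ) + σ + t * I ≠ 1 := by
      intro h1
      have := congrArg Complex.re h1
      simp at this; linarith
    rw [← mellin_mertens_eq_of_integrable hI hs hs1, ← laplace_normalizedMertens_eq_mellin]
    refine integral_congr_ae (ae_of_all _ fun u ↦ ?_)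
    dsimp only
    congr 2
    ring

end Literature.NumberTheory.LFunctions
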